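import Summits.ABC.ABC.Theorems.IsogenyGlueCongruenceKenkuPrintedLevelsLevelThirtyFive
import Literature.NumberTheory.EllipticCurves.KubertTwoTenProofs
import HarnessLib

/-!
# `KenkuPrintedLevels` (stmt-ABC-18224) (ii), level `35`: the hyperelliptic model of `X₀(35)`, its
# `w₅`-quotient `35a1 : Y² = X³ + (4X + 28)²`, and level `35` MODULO two explicit inputs

`Summits/ABC/ABC/Theorems/IsogenyGlueCongruenceKenkuPrintedLevelsLevelThirtyFiveQuotient.lean` — unit
`abc-inputs-pr-1` (KEY A1L-SWEEP parcel 2; INPUTS-LIST row I-07; progress, not closure), continuing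
`…KenkuPrintedLevelsLevelThirtyFive.lean` (`isCyclic_degree_ne_thirtyFive_of_fibreProduct`: level `35`
⟸ `D₃₅` = the Klein–Fricke `5 × 7` fibre product
`F(H,t) := (H² + 10H + 5)³ t − (t² + 13t + 49)(t² + 5t + 1)³ H = 0` has no rational point with `H t ≠ 0`).
PROOFS ONLY (0 definitions, 0 named facts).

## The mathematics (derived and checked numerically this session; see the item's evidence file)

With `H = 125 (η(5τ)/η(τ))⁶`, `t = 49 (η(7τ)/η(τ))⁴` (so `j = (H²+10H+5)³/H = (t²+13t+49)(t²+5t+1)³/t`)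
and the Hauptmodul `x = η(5τ)η(7τ)/(η(τ)η(35τ))` of `X₀(35)/w₃₅`, the curve `X₀(35)` (genus `3`,
hyperelliptic) is

  `y² = f₈(x) := x⁸ − 4x⁷ − 6x⁶ − 4x⁵ − 9x⁴ + 4x³ − 6x² + 4x + 1 = (x² + x − 1)(x⁶ − 5x⁵ − 9x³ − 5x − 1)`

(Galbraith's model, recovered here from `S₂(Γ₀(35))`), the four cusps being `x ∈ {0, ∞}`; the
coordinates satisfy `x H² − p₈(x) H + 125 x⁷ = 0` and

  `Ψ(x,t) := x t² − p₆(x) t + 49 x⁵ = 0`,  `p₆(x) = x⁶ − 5x⁵ + 5x³ − 5x − 1`,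

with `p₆(x)² − 196 x⁶ = f₈(x) · (x² − 3x − 1)²`. The Atkin–Lehner involution `w₅` is `(x, y) ↦ (−1/x, y/x⁴)`;
the quotient `X₀(35)/w₅` is the elliptic curve Cremona **`35a1`**, reached by
`(x, y) ↦ (X, Y) = (−28x/(x² + x − 1), 28y/(x² + x − 1)²)` onto **`Y² = X³ + (4X + 28)²`**
(`= x³ + 16x² + 224x + 784`; `c₄ = −2⁴·416`, `c₆ = 2⁶·1448`, `Δ = −2¹²·5³·7³`: the `u = 2` rescaling of
`[0,1,1,9,1]`; in the tree's vocabulary `threeTorsionModel 4 28` of `ThreeIsogeny.lean`, `T = (0, 28)` of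
order `3`). The cusps go to `±T = (0, ±28)`, the fibre over `O` is `x² + x − 1 = 0` (irrational), so a
non-cuspidal rational point of `X₀(35)` would give a rational point of `35a1` outside `{O, ±T}` — and
`35a1(ℚ) ≅ ℤ/3` (Cremona; rank `0` by `3`-descent) says there is none.

## What this file PROVES (all elementary algebra, `ring`/`linear_combination`):

* `thirtyFiveA1_of_hyperelliptic35` — the quotient map lands on `35a1` (polynomial identity
  `(x² − 3x − 1)²(x² + x − 1) − 28x³ = x⁶ − 5x⁵ − 9x³ − 5x − 1`); `X = 0` only for `x = 0`;
* `hyperelliptic35_x_eq_zero_of_mordellWeil` — **if `35a1(ℚ) = {O, (0, ±28)}`** (displayed hypothesis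
  `hMW : ∀ X Y : ℚ, Y² = X³ + (4X + 28)² → X = 0`) then every rational point of `y² = f₈(x)` has `x = 0`;
* `hyperelliptic35_of_psi` — a rational solution of `Ψ(x,t) = 0` with `t ≠ 0` has `x ≠ 0` and gives a rational
  point `(x, y)` of `y² = f₈(x)` (`y = (2xt − p₆(x))/(x² − 3x − 1)`, `13` not a rational square);
* `fibreProduct_thirtyFive_empty_of_link_of_mordellWeil`, `isCyclic_degree_ne_thirtyFive_of_link_of_mordellWeil`
  — `D₃₅`, hence level `35`, follow from `hMW` and the displayed hypothesis
  `hLink : ∀ H t, H ≠ 0 → t ≠ 0 → F(H,t) = 0 → ∃ x, Ψ(x,t) = 0` (the coordinate `x` of the point of `X₀(35)`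
  over the fibre-product point).

## What is NOT here (the two remaining inputs, both explicit):

* `hLink`: `x ∈ ℚ(H,t)` is explicit — `x = −A₀(H,t)/B₀(H,t) = −A₁(H,t)/B₁(H,t)` with `Aᵢ, Bᵢ ∈ ℤ[H,t]` of
  bidegree `(4,4)` (15–17 terms), and `B₀⁶ Ψ(−A₀/B₀, t) = M₀ · F` with `M₀ ∈ ℤ[H,t]` of 243 terms (bidegree
  `(18,18)`), likewise `M₁` (287 terms), while `Res_t(B₀,B₁) = H · R₂₂(H)` with `R₂₂` free of rational roots —
  a finite polynomial-identity certificate of the size the tree's `PolyCert` kernel checker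
  (`KleinFrickeSevenCertificateKernel.lean`) already handles; data attached to the item as evidence;
* `hMW`: the Mordell–Weil group of `35a1` (`3`-isogeny descent; Vélu's `3`-isogeny with kernel `⟨(0,28)⟩` is
  `ThreeIsogeny.lean`, the Selmer computation is not in the tree).

Nothing is conditional on a named fact; no summit, rung or item is proved; abc moved by 0.
-/

-- `Summit.ABC.ABC` is the mandated summit-side namespace (CONVENTIONS §2); the duplicate is deliberate.
set_option linter.dupNamespace false

noncomputable section
open WeierstrassCurve
open Literature.NumberTheory.EllipticCurves

namespace Summit.ABC.ABC.Theorems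

/-! ### Small irrationalities -/

/-- `13` is not a rational square. [folklore] -/
theorem rat_sq_ne_thirteen (q : ℚ) : q ^ 2 ≠ 13 := by
  intro h
  have hp : Nat.Prime 13 := by norm_num
  refine hp.irrational_sqrt ⟨|q|, ?_⟩
  have hq : ((|q| : ℚ) : ℝ) ^ 2 = ((13 : ℕ) : ℝ) := by
    rw [Rat.cast_abs, sq_abs, ← Rat.cast_pow, h]; norm_num
  rw [← Real.sqrt_sq (by positivity : (0 : ℝ) ≤ ((|q| : ℚ) : ℝ)), hq]

/-- `x² − 3x − 1` has no rational root (`(2x − 3)² = 13`). [folklore] -/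
theorem sq_sub_three_mul_sub_one_ne_zero (x : ℚ) : x ^ 2 - 3 * x - 1 ≠ 0 := fun h ↦
  rat_sq_ne_thirteen (2 * x - 3) (by linear_combination 4 * h)

/-! ### The `w₅`-quotient of the hyperelliptic model of `X₀(35)` is `35a1` -/

/-- **`X₀(35) → X₀(35)/w₅ = 35a1`, explicitly.** If `y² = f₈(x)`,
`f₈(x) = x⁸ − 4x⁷ − 6x⁶ − 4x⁵ − 9x⁴ + 4x³ − 6x² + 4x + 1 = (x² + x − 1)(x⁶ − 5x⁵ − 9x³ − 5x − 1)` (Galbraith's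
model of `X₀(35)`), and `X (x² + x − 1) = −28x`, `Y (x² + x − 1)² = 28y` (i.e. `X = −28x/(x² + x − 1)`,
`Y = 28y/(x² + x − 1)²`, the denominator having no rational zero), then `Y² = X³ + (4X + 28)²` (Cremona `35a1`,
`= threeTorsionModel 4 28`). The identity behind it: `(x² − 3x − 1)²(x² + x − 1) − 28x³ = x⁶ − 5x⁵ − 9x³ − 5x − 1`.
[folklore] -/
theorem thirtyFiveA1_of_hyperelliptic35 {x y X Y : ℚ}
    (h : y ^ 2 = x ^ 8 - 4 * x ^ 7 - 6 * x ^ 6 - 4 * x ^ 5 - 9 * x ^ 4 + 4 * x ^ 3 - 6 * x ^ 2 + 4 * x + 1)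
    (hX : X * (x ^ 2 + x - 1) = -28 * x) (hY : Y * (x ^ 2 + x - 1) ^ 2 = 28 * y) :
    Y ^ 2 = X ^ 3 + (4 * X + 28) ^ 2 := by
  have hq : x ^ 2 + x - 1 ≠ 0 := Rat.sq_add_self_sub_one_ne_zero x
  have key : (x ^ 2 + x - 1) ^ 4 * (Y ^ 2 - (X ^ 3 + (4 * X + 28) ^ 2)) = 0 := by
    linear_combination
      (-(x ^ 2 + x - 1) * ((X * (x ^ 2 + x - 1)) ^ 2 - 28 * x * (X * (x ^ 2 + x - 1)) + 784 * x ^ 2) -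
          4 * (x ^ 2 + x - 1) ^ 2 * (4 * X * (x ^ 2 + x - 1) - 112 * x + 56 * (x ^ 2 + x - 1))) * hX +
        (Y * (x ^ 2 + x - 1) ^ 2 + 28 * y) * hY + 784 * h
  have := (mul_eq_zero.mp key).resolve_left (pow_ne_zero 4 hq)
  linarith

/-- **Rational points of the hyperelliptic model of `X₀(35)`, granted the Mordell–Weil group of `35a1`.**
If `35a1(ℚ) = {O, (0, ±28)}` — displayed hypothesis `hMW`: every rational solution of `Y² = X³ + (4X + 28)²`
has `X = 0` (Cremona: `35a1(ℚ) ≅ ℤ/3`; NOT proved here) — then every rational point of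
`y² = f₈(x)` has `x = 0` (i.e. is one of the two affine cusps `(0, ±1)`): otherwise
`thirtyFiveA1_of_hyperelliptic35` gives the rational point `(−28x/(x²+x−1), 28y/(x²+x−1)²)` of `35a1` with
`X ≠ 0`. [cite: Kenku1982, Thm. 1 and its proof, pp. 199–201] -/
theorem hyperelliptic35_x_eq_zero_of_mordellWeil
    (hMW : ∀ X Y : ℚ, Y ^ 2 = X ^ 3 + (4 * X + 28) ^ 2 → X = 0) {x y : ℚ}
    (h : y ^ 2 = x ^ 8 - 4 * x ^ 7 - 6 * x ^ 6 - 4 * x ^ 5 - 9 * x ^ 4 + 4 * x ^ 3 - 6 * x ^ 2 + 4 * x + 1) :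
    x = 0 := by
  have hq : x ^ 2 + x - 1 ≠ 0 := Rat.sq_add_self_sub_one_ne_zero x
  by_contra hx
  have hX : -28 * x / (x ^ 2 + x - 1) * (x ^ 2 + x - 1) = -28 * x := div_mul_cancel₀ _ hq
  have hY : 28 * y / (x ^ 2 + x - 1) ^ 2 * (x ^ 2 + x - 1) ^ 2 = 28 * y :=
    div_mul_cancel₀ _ (pow_ne_zero 2 hq)
  have hX0 := hMW _ _ (thirtyFiveA1_of_hyperelliptic35 h hX hY)
  rw [hX0, zero_mul] at hX
  exact hx (by linarith)

/-! ### From the coordinate relation `Ψ(x,t) = 0` to a point of the hyperelliptic model -/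

/-- **`Ψ(x,t) = 0` gives a rational point of `y² = f₈(x)` with `x ≠ 0`.** If `x t² − p₆(x) t + 49x⁵ = 0` with
`p₆(x) = x⁶ − 5x⁵ + 5x³ − 5x − 1` and `t ≠ 0` (the relation between the Hauptmodul `x` of `X₀(35)/w₃₅` and
the level-`7` coordinate `t`), then `x ≠ 0` (`Ψ(0,t) = t`) and, since
`(2xt − p₆(x))² = p₆(x)² − 196x⁶ = f₈(x)·(x² − 3x − 1)²` with `x² − 3x − 1 ≠ 0` over `ℚ`,
`y = (2xt − p₆(x))/(x² − 3x − 1)` satisfies `y² = f₈(x)`. [folklore] -/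
theorem hyperelliptic35_of_psi {x t : ℚ} (ht : t ≠ 0)
    (hΨ : x * t ^ 2 - (x ^ 6 - 5 * x ^ 5 + 5 * x ^ 3 - 5 * x - 1) * t + 49 * x ^ 5 = 0) :
    x ≠ 0 ∧ ∃ y : ℚ,
      y ^ 2 = x ^ 8 - 4 * x ^ 7 - 6 * x ^ 6 - 4 * x ^ 5 - 9 * x ^ 4 + 4 * x ^ 3 - 6 * x ^ 2 + 4 * x + 1 := by
  have hx : x ≠ 0 := by
    rintro rfl
    apply ht
    linear_combination hΨ
  have hr : x ^ 2 - 3 * x - 1 ≠ 0 := sq_sub_three_mul_sub_one_ne_zero x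
  refine ⟨hx, (2 * x * t - (x ^ 6 - 5 * x ^ 5 + 5 * x ^ 3 - 5 * x - 1)) / (x ^ 2 - 3 * x - 1), ?_⟩
  rw [div_pow, div_eq_iff (pow_ne_zero 2 hr)]
  linear_combination (4 * x) * hΨ

/-! ### Level `35` modulo the two explicit inputs -/

/-- **`D₃₅` from the coordinate link and the Mordell–Weil group of `35a1`.** Displayed hypotheses:
`hLink` — over every rational point `(H, t)`, `H t ≠ 0`, of the Klein–Fricke `5 × 7` fibre product there is a
rational `x` with `Ψ(x,t) = x t² − p₆(x) t + 49x⁵ = 0` (the Hauptmodul of `X₀(35)/w₃₅` at that point; an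
explicit rational function of `(H, t)`, NOT verified here); `hMW` — `35a1(ℚ) = {O, (0, ±28)}` (NOT proved here).
Then the fibre product has no rational point with `H t ≠ 0`. [cite: Kenku1982, Thm. 1 and its proof, pp. 199–201] -/
theorem fibreProduct_thirtyFive_empty_of_link_of_mordellWeil
    (hLink : ∀ H t : ℚ, H ≠ 0 → t ≠ 0 →
      (H ^ 2 + 10 * H + 5) ^ 3 * t = (t ^ 2 + 13 * t + 49) * (t ^ 2 + 5 * t + 1) ^ 3 * H →
      ∃ x : ℚ, x * t ^ 2 - (x ^ 6 - 5 * x ^ 5 + 5 * x ^ 3 - 5 * x - 1) * t + 49 * x ^ 5 = 0)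
    (hMW : ∀ X Y : ℚ, Y ^ 2 = X ^ 3 + (4 * X + 28) ^ 2 → X = 0) :
    ∀ H t : ℚ, H ≠ 0 → t ≠ 0 →
      (H ^ 2 + 10 * H + 5) ^ 3 * t ≠ (t ^ 2 + 13 * t + 49) * (t ^ 2 + 5 * t + 1) ^ 3 * H := by
  intro H t hH ht hF
  obtain ⟨x, hΨ⟩ := hLink H t hH ht hF
  obtain ⟨hx, y, hy⟩ := hyperelliptic35_of_psi ht hΨ
  exact hx (hyperelliptic35_x_eq_zero_of_mordellWeil hMW hy)

/-- **Level `35` of `KenkuPrintedLevels` (ii) modulo the two explicit inputs** `hLink` (coordinate link on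
the fibre product, a finite polynomial-identity certificate) and `hMW` (`35a1(ℚ) ≅ ℤ/3`): no elliptic curve
over `ℚ` admits a cyclic `ℚ`-isogeny of degree `35`
(`isCyclic_degree_ne_thirtyFive_of_fibreProduct` ∘ `fibreProduct_thirtyFive_empty_of_link_of_mordellWeil`).
[cite: Kenku1982, Thm. 1 and its proof, pp. 199–201] -/
theorem isCyclic_degree_ne_thirtyFive_of_link_of_mordellWeil
    (hLink : ∀ H t : ℚ, H ≠ 0 → t ≠ 0 →
      (H ^ 2 + 10 * H + 5) ^ 3 * t = (t ^ 2 + 13 * t + 49) * (t ^ 2 + 5 * t + 1) ^ 3 * H →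
      ∃ x : ℚ, x * t ^ 2 - (x ^ 6 - 5 * x ^ 5 + 5 * x ^ 3 - 5 * x - 1) * t + 49 * x ^ 5 = 0)
    (hMW : ∀ X Y : ℚ, Y ^ 2 = X ^ 3 + (4 * X + 28) ^ 2 → X = 0)
    (V V' : WeierstrassCurve ℚ) [V.IsElliptic] [V'.IsElliptic] (ψ : Isogeny V V')
    (hψ : ψ.IsCyclic) : ψ.degree ≠ 35 :=
  isCyclic_degree_ne_thirtyFive_of_fibreProduct
    (fibreProduct_thirtyFive_empty_of_link_of_mordellWeil hLink hMW) V V' ψ hψ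

end Summit.ABC.ABC.Theorems

end
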